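import Mathlib
import Summits.KontsevichZagierPeriods.KontsevichZagierPeriods.Theorems.SoloInformedKZPUpToWall
import Summits.KontsevichZagierPeriods.KontsevichZagierPeriods.Theorems.SoloInformedVolumeCube
import HarnessLib
import HarnessLib.Audit

/-!
# SoloInformed — what the truncations `KZPUpTo N` decide, II: certificates against pairs

Solo programme `solo-KontsevichZagierPeriods-informed`, session s118 (sequel to
`SoloInformedKZPUpToWall`).

A *certificate* relating two representations `R`, `R'` is a relation
`p·[R] − q·[R'] ∈ KZ.relations` with `p, q ≥ 1` (a finite chain of the moves between the formal
multiples); `SoloInformedNoPairCert R R'` says that none exists — literally the `NoRel` shape of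
the wall-face statements of the residency's paper (`main.md` §3), now for two RATIONAL
representations of dimensions `≤ N` instead of two solids.

* `soloInformed_value_eq_of_nsmul_sub_nsmul_mem_relations` — soundness: a certificate forces
  `p·value R = q·value R'` (unconditional).
* `soloInformed_kzpUpTo_noPairCert_iff` — **`KZPUpTo n → (NoPairCert R R' ↔ ∀ p q ≥ 1,
  p·value R ≠ q·value R')`** for rational `R`, `R'` of dimensions `≤ n`: the truncation is applied
  once, to the rational representations `[D, p f]` and `[D', q f']` (`soloInformedConstMulRep`,
  rule (1b): `c·[D,f] ∼ [D, c f]`, `soloInformed_nsmul_of_sub_of_constMulRep`).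
* Faces.  With `Z_n = [(0,1)ⁿ, 1/(1 − ∏ xᵢ)]` (value `ζ(n)`, file `SoloInformedKZPUpToWall`) and
  the two-dimensional rational representation `L = [(0,1)², 1/((1 + x₀)(1 + 2x₁))]` of
  `log 2 · log 3 / 2` (`soloInformed_value_logPairRep`, Fubini and two logarithmic primitives):
  **`KZPUpTo 2 → (NoPairCert Z₂ L ↔ ∀ p q ≥ 1, p π² ≠ q log 2 log 3)`**
  (`soloInformed_kzpUpTo_two_noPairCert_fourExp_iff`; the right-hand side is the `(2,3)` case of
  the weak four-exponentials conjecture, `π² ∉ ℚ·log 2·log 3`, OPEN), and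
  **`KZPUpTo 3 → (NoPairCert Z₃ Z₂ ↔ ∀ p q ≥ 1, p ζ(3) ≠ q ζ(2))`** (`ζ(3)/π² ∉ ℚ`, OPEN).

Together with the Catalan face of `SoloInformedKZPUpToWall` this is the kernel form of the
statement "where the truncation ladder stops": `KZPUpTo 1` is a theorem; the first undecided
truncation `KZPUpTo 2` is EQUIVALENT, face by face, to certificate statements whose arithmetic
sides are the irrationality of Catalan's constant and `π² ∉ ℚ·log 2·log 3`.

References: M. Kontsevich, D. Zagier, *Periods* (2001), §1.1–1.2; M. Waldschmidt, *Open
Diophantine problems*, Moscow Math. J. 4 (2004), §3 (four exponentials conjecture; `ζ(3)/π²`);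
J. Ayoub, EMS Newsl. 91 (2014), Conj. 7, Rem. 13.
-/

noncomputable section

open MeasureTheory Set Filter
open scoped Topology BigOperators

namespace Summit.KontsevichZagierPeriods.KontsevichZagierPeriods.Theorems

open Literature.NumberTheory.Transcendental Literature.NumberTheory.Transcendental.KZ

variable {n k k' : ℕ}

/-! ### Certificates against pairs -/

/-- **No certificate between `R` and `R'`**: no relation `p·[R] − q·[R'] ∈ KZ.relations` with
`p, q ≥ 1`. [this work] -/
def SoloInformedNoPairCert (R : IntegralRep k) (R' : IntegralRep k') : Prop :=
  ∀ p q : ℕ, p ≠ 0 → q ≠ 0 → p • of R - q • of R' ∉ relations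

/-- Soundness: a certificate `p·[R] − q·[R'] ∈ relations` forces `p·value R = q·value R'`.
[Kontsevich–Zagier 2001, §1.2] -/
theorem soloInformed_value_eq_of_nsmul_sub_nsmul_mem_relations {R : IntegralRep k}
    {R' : IntegralRep k'} {p q : ℕ} (h : p • of R - q • of R' ∈ relations) :
    (p : ℝ) * R.value = q * R'.value := by
  have h0 : eval (p • of R - q • of R') = 0 := relations_le_ker_eval_holds h
  rwa [map_sub, map_nsmul, map_nsmul, eval_of, eval_of, nsmul_eq_mul, nsmul_eq_mul,
    sub_eq_zero] at h0

/-- **Soundness direction (unconditional)**: if no `p·value R = q·value R'` holds then there is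
no certificate. -/
theorem soloInformed_noPairCert_of_ne {R : IntegralRep k} {R' : IntegralRep k'}
    (h : ∀ p q : ℕ, p ≠ 0 → q ≠ 0 → (p : ℝ) * R.value ≠ q * R'.value) :
    SoloInformedNoPairCert R R' :=
  fun p q hp hq hmem => h p q hp hq (soloInformed_value_eq_of_nsmul_sub_nsmul_mem_relations hmem)

/-- `value [D, c f] = c · value [D, f]`. -/
theorem soloInformed_value_constMulRep (R : IntegralRep k) (c : ℚ) :
    (soloInformedConstMulRep R c).value = (c : ℝ) * R.value := by
  show ∫ x in R.domain, (c : ℝ) * R.integrand x = (c : ℝ) * ∫ x in R.domain, R.integrand x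
  exact integral_const_mul _ _

/-- `[D, c f]` has KZ's literal rational shape when `[D, f]` has (`c ∈ ℚ`). -/
theorem soloInformed_constMulRep_isRational {R : IntegralRep k} (hR : R.IsRational) (c : ℚ) :
    (soloInformedConstMulRep R c).IsRational := by
  obtain ⟨p, q, hq, hpq⟩ := hR
  refine ⟨MvPolynomial.C c * p, q, hq, fun x hx => ?_⟩
  show (c : ℝ) * R.integrand x =
    MvPolynomial.aeval x (MvPolynomial.C c * p) / MvPolynomial.aeval x q
  rw [show R.integrand x = MvPolynomial.aeval x p / MvPolynomial.aeval x q from hpq hx, map_mul,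
    MvPolynomial.aeval_C, eq_ratCast, mul_div_assoc]

/-- Under `KZPUpTo n` a positive-rational ratio of the values of two rational representations
of dimensions `≤ n` PRODUCES a certificate: the truncation is applied once, to `[D, p f]` and
`[D', q f']`, and rule (1b) (`c·[D,f] ∼ [D, c f]`) supplies the two ends. [this work] -/
theorem soloInformed_kzpUpTo_pairCert (h : SoloInformedKZPUpTo n) (R : IntegralRep k)
    (R' : IntegralRep k') (hk : k ≤ n) (hk' : k' ≤ n) (hR : R.IsRational) (hR' : R'.IsRational)
    (p q : ℕ) (heq : (p : ℝ) * R.value = q * R'.value) :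
    p • of R - q • of R' ∈ relations := by
  have hE : Equivalent (soloInformedConstMulRep R (p : ℚ)) (soloInformedConstMulRep R' (q : ℚ)) :=
    h _ _ hk hk' (soloInformed_constMulRep_isRational hR _)
      (soloInformed_constMulRep_isRational hR' _)
      (by rw [soloInformed_value_constMulRep, soloInformed_value_constMulRep]; push_cast; exact heq)
  have e : p • of R - q • of R' =
      (p • of R - of (soloInformedConstMulRep R (p : ℚ))) +
        (of (soloInformedConstMulRep R (p : ℚ)) - of (soloInformedConstMulRep R' (q : ℚ))) -
        (q • of R' - of (soloInformedConstMulRep R' (q : ℚ))) := by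
    abel
  rw [e]
  exact relations.sub_mem (relations.add_mem (soloInformed_nsmul_of_sub_of_constMulRep R p) hE)
    (soloInformed_nsmul_of_sub_of_constMulRep R' q)

/-- **`KZPUpTo n → (NoPairCert R R' ↔ ∀ p q ≥ 1, p·value R ≠ q·value R')`** for rational
representations `R`, `R'` of dimensions `≤ n`: under the truncated period conjecture the absence
of a certificate is exactly the absence of a positive-rational ratio of the values. [this work] -/
theorem soloInformed_kzpUpTo_noPairCert_iff (h : SoloInformedKZPUpTo n) (R : IntegralRep k)
    (R' : IntegralRep k') (hk : k ≤ n) (hk' : k' ≤ n) (hR : R.IsRational) (hR' : R'.IsRational) :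
    SoloInformedNoPairCert R R' ↔
      ∀ p q : ℕ, p ≠ 0 → q ≠ 0 → (p : ℝ) * R.value ≠ q * R'.value :=
  ⟨fun hno p q hp hq heq => hno p q hp hq
      (soloInformed_kzpUpTo_pairCert h R R' hk hk' hR hR' p q heq),
    soloInformed_noPairCert_of_ne⟩

/-- Dimensions `≤ 1`: decided unconditionally (the theorem `KZPUpTo 1`). -/
theorem soloInformed_noPairCert_iff_of_dim_le_one (R : IntegralRep k) (R' : IntegralRep k')
    (hk : k ≤ 1) (hk' : k' ≤ 1) (hR : R.IsRational) (hR' : R'.IsRational) :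
    SoloInformedNoPairCert R R' ↔
      ∀ p q : ℕ, p ≠ 0 → q ≠ 0 → (p : ℝ) * R.value ≠ q * R'.value :=
  soloInformed_kzpUpTo_noPairCert_iff soloInformed_kzpUpTo_one R R' hk hk' hR hR'

/-! ### The representation `L = [(0,1)², 1/((1 + x₀)(1 + 2x₁))]` of `log 2 · log 3 / 2` -/

/-- `∫_{(0,1)} dt/(1 + t) = log 2`. [folklore] -/
theorem soloInformed_integral_one_div_one_add :
    ∫ t in Ioo (0 : ℝ) 1, 1 / (1 + t) = Real.log 2 := by
  have hderiv : ∀ x ∈ Set.uIcc (0 : ℝ) 1,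
      HasDerivAt (fun t => Real.log (1 + t)) (1 / (1 + x)) x := by
    intro x hx
    rw [Set.uIcc_of_le zero_le_one] at hx
    exact ((hasDerivAt_id' x).const_add 1).log (by linarith [hx.1])
  have hint : IntervalIntegrable (fun t : ℝ => 1 / (1 + t)) volume 0 1 := by
    refine (continuousOn_const.div (by fun_prop) fun x hx => ?_).intervalIntegrable
    rw [Set.uIcc_of_le zero_le_one] at hx
    exact (by linarith [hx.1] : (0 : ℝ) < 1 + x).ne'
  rw [← integral_Ioc_eq_integral_Ioo, ← intervalIntegral.integral_of_le zero_le_one,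
    intervalIntegral.integral_eq_sub_of_hasDerivAt hderiv hint]
  norm_num

/-- `∫_{(0,1)} dt/(1 + 2t) = log 3 / 2`. [folklore] -/
theorem soloInformed_integral_one_div_one_add_two_mul :
    ∫ t in Ioo (0 : ℝ) 1, 1 / (1 + 2 * t) = Real.log 3 / 2 := by
  have hderiv : ∀ x ∈ Set.uIcc (0 : ℝ) 1,
      HasDerivAt (fun t => Real.log (1 + 2 * t) / 2) (1 / (1 + 2 * x)) x := by
    intro x hx
    rw [Set.uIcc_of_le zero_le_one] at hx
    have hx0 : (0 : ℝ) < 1 + 2 * x := by linarith [hx.1]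
    have h := ((((hasDerivAt_id' x).const_mul (2 : ℝ)).const_add 1).log hx0.ne').div_const 2
    exact h.congr_deriv (by ring)
  have hint : IntervalIntegrable (fun t : ℝ => 1 / (1 + 2 * t)) volume 0 1 := by
    refine (continuousOn_const.div (by fun_prop) fun x hx => ?_).intervalIntegrable
    rw [Set.uIcc_of_le zero_le_one] at hx
    exact (by linarith [hx.1] : (0 : ℝ) < 1 + 2 * x).ne'
  rw [← integral_Ioc_eq_integral_Ioo, ← intervalIntegral.integral_of_le zero_le_one,
    intervalIntegral.integral_eq_sub_of_hasDerivAt hderiv hint]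
  norm_num

/-- `aeval x ((1 + X₀)(1 + 2X₁)) = (1 + x 0)(1 + 2 x 1)`. -/
theorem soloInformed_aeval_logPairDen (x : Fin 2 → ℝ) :
    MvPolynomial.aeval x ((1 + MvPolynomial.X 0) * (1 + 2 * MvPolynomial.X 1) :
      MvPolynomial (Fin 2) ℚ) = (1 + x 0) * (1 + 2 * x 1) := by
  simp

/-- `x ↦ 1/((1 + x₀)(1 + 2x₁))` is integrable on the open unit square (continuous on the closed
one). -/
theorem soloInformed_integrableOn_logPairIntegrand :
    IntegrableOn (fun x : Fin 2 → ℝ => 1 / ((1 + x 0) * (1 + 2 * x 1)))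
      {x : Fin 2 → ℝ | ∀ i, x i ∈ Ioo (0 : ℝ) 1} volume := by
  have hc : ContinuousOn (fun x : Fin 2 → ℝ => 1 / ((1 + x 0) * (1 + 2 * x 1)))
      (Set.pi Set.univ fun _ : Fin 2 => Icc (0 : ℝ) 1) := by
    refine continuousOn_const.div (Continuous.continuousOn (by fun_prop)) fun x hx => ?_
    have h0 : (0 : ℝ) ≤ x 0 := (hx 0 (Set.mem_univ _)).1
    have h1 : (0 : ℝ) ≤ x 1 := (hx 1 (Set.mem_univ _)).1
    exact (mul_pos (by linarith) (by linarith)).ne'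
  refine (hc.integrableOn_compact
    (isCompact_univ_pi fun _ : Fin 2 => (isCompact_Icc : IsCompact (Icc (0 : ℝ) 1)))).mono_set ?_
  rw [Beukers.setOf_forall_mem_Ioo_eq_pi]
  exact Set.pi_mono fun _ _ => Ioo_subset_Icc_self

/-- **`L = [(0,1)², 1/((1 + x₀)(1 + 2x₁))]`**, a two-dimensional representation of KZ's literal
rational shape. [Kontsevich–Zagier 2001, §1.1] -/
def soloInformedLogPairRep : IntegralRep 2 :=
  IntegralRep.ofRational {x : Fin 2 → ℝ | ∀ i, x i ∈ Ioo (0 : ℝ) 1} 1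
    ((1 + MvPolynomial.X 0) * (1 + 2 * MvPolynomial.X 1)) (KZ.isSemialgebraic_box 2)
    (fun x hx => by
      rw [soloInformed_aeval_logPairDen]
      exact (mul_pos (by linarith [(hx 0).1]) (by linarith [(hx 1).1])).ne')
    (soloInformed_integrableOn_logPairIntegrand.congr_fun
      (fun x _ => by rw [map_one, soloInformed_aeval_logPairDen]) (Beukers.measurableSet_cube 2))

/-- `L` has KZ's literal rational shape. -/
theorem soloInformed_logPairRep_isRational : soloInformedLogPairRep.IsRational :=
  IntegralRep.isRational_ofRational _ _ _ _ _ _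

/-- **`value L = log 2 · (log 3 / 2)`** (Fubini over the square and the two logarithmic
primitives). [folklore] -/
theorem soloInformed_value_logPairRep :
    soloInformedLogPairRep.value = Real.log 2 * (Real.log 3 / 2) := by
  have e : ∀ x : Fin 2 → ℝ, MvPolynomial.aeval x (1 : MvPolynomial (Fin 2) ℚ) /
      MvPolynomial.aeval x ((1 + MvPolynomial.X 0) * (1 + 2 * MvPolynomial.X 1) :
        MvPolynomial (Fin 2) ℚ) = 1 / (1 + x 0) * (1 / (1 + 2 * x 1)) := fun x => by
    rw [map_one, soloInformed_aeval_logPairDen, one_div_mul_one_div]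
  rw [soloInformedLogPairRep, IntegralRep.value_ofRational]
  simp_rw [e]
  rw [Beukers.volume_restrict_cube 2]
  have h := integral_fintype_prod_eq_prod (𝕜 := ℝ)
    (fun i : Fin 2 => (![fun t : ℝ => 1 / (1 + t), fun t : ℝ => 1 / (1 + 2 * t)] i))
    (μ := fun _ : Fin 2 => (volume : Measure ℝ).restrict (Ioo 0 1))
  simp only [Fin.prod_univ_two, Matrix.cons_val_zero, Matrix.cons_val_one] at h
  rw [h, soloInformed_integral_one_div_one_add, soloInformed_integral_one_div_one_add_two_mul]

/-! ### Faces -/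

/-- **`KZPUpTo 2 → (NoPairCert Z₂ L ↔ ∀ p q ≥ 1, p ζ(2) ≠ q · log 2 log 3 / 2)`.** -/
theorem soloInformed_kzpUpTo_two_noPairCert_zeta_two_logPair_iff (h : SoloInformedKZPUpTo 2) :
    SoloInformedNoPairCert (soloInformedZetaBoxRep 2 le_rfl) soloInformedLogPairRep ↔
      ∀ p q : ℕ, p ≠ 0 → q ≠ 0 →
        (p : ℝ) * zetaValue 2 ≠ q * (Real.log 2 * (Real.log 3 / 2)) := by
  rw [← soloInformed_value_zetaBoxRep (le_refl 2), ← soloInformed_value_logPairRep]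
  exact soloInformed_kzpUpTo_noPairCert_iff h _ _ le_rfl le_rfl
    (soloInformed_zetaBoxRep_isRational _) soloInformed_logPairRep_isRational

/-- **Face `(C4EW)(2,3)` of the first undecided truncation:
`KZPUpTo 2 → (NoPairCert Z₂ L ↔ ∀ p q ≥ 1, p π² ≠ q log 2 log 3)`** — the right-hand side,
`π² ∉ ℚ_{>0} · log 2 · log 3`, is the `(2,3)` case of the weak four-exponentials conjecture
(OPEN). [this work; Waldschmidt 2004, §3] -/
theorem soloInformed_kzpUpTo_two_noPairCert_fourExp_iff (h : SoloInformedKZPUpTo 2) :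
    SoloInformedNoPairCert (soloInformedZetaBoxRep 2 le_rfl) soloInformedLogPairRep ↔
      ∀ p q : ℕ, p ≠ 0 → q ≠ 0 → (p : ℝ) * Real.pi ^ 2 ≠ q * (Real.log 2 * Real.log 3) := by
  rw [soloInformed_kzpUpTo_two_noPairCert_zeta_two_logPair_iff h]
  have hz : zetaValue 2 = Real.pi ^ 2 / 6 := by
    rw [zetaValue]
    exact hasSum_zeta_two.tsum_eq
  rw [hz]
  refine ⟨fun H p q hp hq heq => H (3 * p) q (by omega) hq ?_,
    fun H p q hp hq heq => H p (3 * q) hp (by omega) ?_⟩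
  · push_cast
    linear_combination (1 / 2 : ℝ) * heq
  · push_cast
    linear_combination (6 : ℝ) * heq

/-- **`KZPUpTo 3 → (NoPairCert Z₃ Z₂ ↔ ∀ p q ≥ 1, p ζ(3) ≠ q ζ(2))`** — the right-hand side,
`ζ(3)/π² ∉ ℚ`, is OPEN. [this work; Waldschmidt 2004, §3] -/
theorem soloInformed_kzpUpTo_three_noPairCert_zeta_three_two_iff (h : SoloInformedKZPUpTo 3) :
    SoloInformedNoPairCert (soloInformedZetaBoxRep 3 (by norm_num))
        (soloInformedZetaBoxRep 2 le_rfl) ↔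
      ∀ p q : ℕ, p ≠ 0 → q ≠ 0 → (p : ℝ) * zetaValue 3 ≠ q * zetaValue 2 := by
  rw [← soloInformed_value_zetaBoxRep (by norm_num : 2 ≤ 3),
    ← soloInformed_value_zetaBoxRep (le_refl 2)]
  exact soloInformed_kzpUpTo_noPairCert_iff h _ _ le_rfl (by norm_num)
    (soloInformed_zetaBoxRep_isRational _) (soloInformed_zetaBoxRep_isRational _)

/-- Consistency with the summit: `KontsevichZagierPeriods` decides the `(C4EW)(2,3)` face. -/
theorem soloInformed_kz_noPairCert_fourExp_iff (hKZ : KontsevichZagierPeriods) :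
    SoloInformedNoPairCert (soloInformedZetaBoxRep 2 le_rfl) soloInformedLogPairRep ↔
      ∀ p q : ℕ, p ≠ 0 → q ≠ 0 → (p : ℝ) * Real.pi ^ 2 ≠ q * (Real.log 2 * Real.log 3) :=
  soloInformed_kzpUpTo_two_noPairCert_fourExp_iff (soloInformed_kzp_iff_forall_kzpUpTo.1 hKZ 2)

/-- Granting Ayoub's conjecture up to torsion: `NoPairCert Z₂ L ↔ π² ∉ ℚ_{>0}·log 2·log 3`. -/
theorem soloInformed_noPairCert_fourExp_iff_of_ayoubKZeffQ (hA : SoloInformedAyoubKZeffQ) :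
    SoloInformedNoPairCert (soloInformedZetaBoxRep 2 le_rfl) soloInformedLogPairRep ↔
      ∀ p q : ℕ, p ≠ 0 → q ≠ 0 → (p : ℝ) * Real.pi ^ 2 ≠ q * (Real.log 2 * Real.log 3) :=
  soloInformed_kzpUpTo_two_noPairCert_fourExp_iff (soloInformed_kzpUpTo_two_of_ayoubKZeffQ hA)

end Summit.KontsevichZagierPeriods.KontsevichZagierPeriods.Theorems
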